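import Summits.QuantumFields.BalabanUV.Beta.GAN24.RespStepBmDecompLegs
import Summits.QuantumFields.BalabanUV.Beta.GAN24.RespStepBmGaugeLaw

/-!
# `BalabanUV.Beta.GAN24.RespStepBmDecompExact` — binder row G-an2-4 / (CONV-C), S-slot road «SREC» on the literal of record (family (E)),
# PART V row V4-c (`SKELETON-SREC` v0.2/v0.3 SR-L4a; RULINGS-16 (R16-3) «SREC-DECOMP», part 2 of 3): THE WINDOW AS `Π_bm` ON ACTED DATA,
# `bmGaugeAt` OF AN `ℓ¹` FORM IS `ℓ¹`, THE ONE-STEP CLOSED FORM AND THE EXACT-DATUM LAW THROUGH THE DRESSED CHAINS —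
# `legAct (legChain D m k) (dz ψ) = ((Lc^{(d+1)(k+1)})⁻¹) • dz (ψ ∘ blk_{Lc^{k+1}})`, `D j = respStepBm ρ Lc (Lc^j) (Lc^(j+1))`

NOT IN PRINT; OUR BOOKKEEPING (G-an2-4 formalisation swarm, leaf prover `b2b-balaban-gan24-formalise-leaf-03`, gen 41; the row owner
`b2b-balaban-gan24-p1` gen 13's RULINGS-16 addendum (R16-3), journal `CLAIMS.log` l.18387, claim l.18445; names PROVISIONAL — the owner may
rename / re-cut).  HONEST FRAMING (cell contract, verbatim): «discharging `BetaPertH` makes Bałaban's UV stability UNCONDITIONAL — a real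
constructive-QFT result; it is NOT the continuum limit and NOT the Clay problem.»  HONEST DEPENDENCY (verbatim): «continuum YM on T⁴ ⇐ BetaPertH ∧
nine spine estimates (0/9 proved); BetaPertH ⇐ (D1) ∧ (D4) ∧ CAP+tail; G-an2-4 gates asym, D1 and NE2/3/4.»

## Contents ([folklore]; part 1 `RespStepBmDecompLegs` = `legAct`, `LegL1`, Fubini)
* §2 **`legAct_bmW`**: `legAct (bmW ρ N R) b = Π^ρ_bm (legAct R b)` (in-block root, summable datum, bounded legs; gan24-p4's `sum_tsum_mul_coProjBmW`
  — the finite window sums come out of the series — and `AxProjBmWindow.axProjBmAt_eq_coProjBmW′` — the projector IS its window matrix);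
  `abs_treeGaugeAt_le_blockMass` ∕ `abs_bmGaugeAt_le_blockMass` ∕ **`summable_bmGaugeAt`**: the block-mean-normalised rooted tree gauge
  `bmGaugeAt (toSite rr) A N` of a componentwise summable form is summable (majorant `2(d+1)N · blockMass ∘ blk`: the rooted twin of
  `AxialDressing.summable_treeGauge` through an2's letter sites `mem_axial_hull` and length bound `axial_length_le_of_root`).
* §3 `respStepBmSeq ρ Lc j := respStepBm ρ Lc (Lc^j) (Lc^(j+1))` (leaf-01's dressed one-step legs as a sequence) and **`legAct_respStepBm_dz`** —
  THE ONE-STEP CLOSED FORM: `legAct (D m) (dz ψ) = ((Lc^{d+1})⁻¹) • dz (ψ ∘ blk_{Lc})` (summable `ψ`; gan24-p4's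
  `RespStepBmGaugeLaw.dressedStep_exact_eq` in the `legAct` currency: `𝒬` of the flat response is the coarse gradient of the block sums, `Π_bm`
  of a gradient is the gradient of the block means, and the block means of the potential are FIXED by the constraint — no Poincaré datum).
* §4 **`legAct_legChain_dz`** — EXACT DATA THROUGH THE CHAIN: `legAct (legChain D m k) (dz ψ) = ((Lc^{(d+1)(k+1)})⁻¹) • dz (ψ ∘ blk_{Lc^{k+1}})`
  (induction on `k` at the source end with part 1's `legAct_legComp` + §3; `blk_{Lc} ∘ blk_{Lc^k} = blk_{Lc^{k+1}}`), with the class facts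
  `exists_legL1_respStepBmSeq` (every `D j ∈ LegL1`) and `exists_abs_legChain_le` (every chain is bounded; constants existential).
One plumbing `def` (`respStepBmSeq`); 0 cited facts, 0 `def … : Prop`, 0 sorry.  NO estimate (SR-L4b, the decay of the dressed legs, is NOT
touched); hypotheses: in-block root, `[NeZero Lc]`, summable data; NO restriction on `d`.  Asserts NO shape of Bałaban's stencils; discharges
NOTHING of (hS, hSall) on (E); 0 wall binders; NEVER «G-an2-4 closed»; NOT D1, NOT BetaPertH, NOT continuum, NOT Clay.
-/

noncomputable section

open Finset
open scoped BigOperators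
open Literature.MathematicalPhysics.QuantumFieldTheory
open Literature.MathematicalPhysics.QuantumFieldTheory.Balaban1983to89
open Literature.MathematicalPhysics.QuantumFieldTheory.Balaban1983to89.Beta
open AffineAveraging (Form0 Form1 Site box toSite unitVec dz)
open AveragingContours (blk axial blk_block)
open AveragingContoursRooted (treeGaugeAt)
open AxialProjector (zsmul_blk_le lt_zsmul_blk_add blk_eq_of_mem_block)
open AxialDressing (blockMass blockMass_nonneg summable_blockMass abs_le_blockMass summable_comp_blk)
open KKTFluctuationEnergy (summable_dz)
open BalabanCompositeJets (respStep)
open Summit.QuantumFields.BalabanUV.Beta.AxialProjectorBlockMean (blockMeanAt bmGaugeAt axProjBmAt)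
open Summit.QuantumFields.BalabanUV.Beta.AxialDressingRooted (coProjBmW mem_axial_hull axial_length_le_of_root)
open Summit.QuantumFields.BalabanUV.Beta.GAN24.Push4Iter (LegFam legChain legChain_zero legChain_succ)
open Summit.QuantumFields.BalabanUV.Beta.GAN24.RespStepBm (bmW respStepBm)
open Summit.QuantumFields.BalabanUV.Beta.GAN24.AxProjBmWindow (axProjBmAt_eq_coProjBmW')
open Summit.QuantumFields.BalabanUV.Beta.GAN24.RespStepBmGaugeStep (sum_tsum_mul_coProjBmW)
open Summit.QuantumFields.BalabanUV.Beta.GAN24.RespStepBmGaugeLaw (dressedStep_exact_eq)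
open Summit.QuantumFields.BalabanUV.Beta.GAN24.RespStepBmDecompLegs (legAct legAct_apply LegL1 summable_legAct legAct_smul legAct_legComp
  abs_legComp_le exists_legL1_respStep legL1_bmW)

namespace Summit.QuantumFields.BalabanUV.Beta.GAN24.RespStepBmDecompExact

variable {d : ℕ}

/-! ## §2 The window is `Π_bm` on the acted datum; the block-mean-normalised gauge of an `ℓ¹` form is `ℓ¹` -/

/-- [folklore] **THE WINDOWED LEGS ACT AS `Π^ρ_bm` OF THE UNDRESSED ACTION** (in-block root, `N ≥ 1`, summable datum, bounded legs):
`legAct (bmW ρ N R) b = Π^ρ_bm (legAct R b)` (gan24-p4's `sum_tsum_mul_coProjBmW` — the finite window sums come out of the series — and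
`axProjBmAt_eq_coProjBmW′` — the projector IS its window matrix). -/
theorem legAct_bmW {b : Form1 (d + 1) ℝ} (hb : ∀ μ, Summable (b μ)) {R : LegFam d} {C : ℝ} (hR : ∀ μ z κ u, |R μ z κ u| ≤ C)
    {N : ℕ} (hN : 1 ≤ N) {rr : Fin (d + 1) → ℕ} (hrr : rr ∈ box (d + 1) N) :
    legAct (bmW (toSite rr) N R) b = axProjBmAt (toSite rr) N (legAct R b) := by
  funext κ u
  rw [legAct_apply, axProjBmAt_eq_coProjBmW' hN hrr]
  have e : ∀ μ y, bmW (toSite rr) N R μ y κ u = coProjBmW (toSite rr) N (R μ y) κ u := fun μ y => rfl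
  simp only [e]
  rw [sum_tsum_mul_coProjBmW (toSite rr) N hb hR κ u]
  rfl

/-- [folklore] A real list with letters bounded by `M` has `|sum| ≤ length · M`. -/
theorem abs_list_sum_le {l : List ℝ} {M : ℝ} (h : ∀ a ∈ l, |a| ≤ M) : |l.sum| ≤ l.length * M := by
  induction l with
  | nil => simp
  | cons a t ih =>
    simp only [List.sum_cons, List.length_cons, Nat.cast_succ]
    have ha := h a (by simp)
    have ht := ih fun x hx => h x (by simp [hx])
    calc |a + t.sum| ≤ |a| + |t.sum| := abs_add_le _ _
      _ ≤ M + t.length * M := add_le_add ha ht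
      _ = (t.length + 1) * M := by ring

/-- [folklore] **THE ROOTED TREE INTEGRAL IS BOUNDED BY THE BLOCK MASS** (in-block root): `|λ^ρ_A(p)| ≤ (d+1)·N · blockMass N A (blk N p)` —
at most `(d+1)·N` letters (an2's `axial_length_le_of_root`), each `±A κ z′` with `z′` in the block of `p` (an2's `mem_axial_hull`), hence bounded by
the block mass (`AxialDressing.abs_le_blockMass`). -/
theorem abs_treeGaugeAt_le_blockMass {N : ℕ} (hN : 1 ≤ N) {rr : Fin (d + 1) → ℕ} (hrr : rr ∈ box (d + 1) N) (A : Form1 (d + 1) ℝ)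
    (p : Site (d + 1)) : |treeGaugeAt (toSite rr) A N p| ≤ (((d : ℝ) + 1) * N) * blockMass N A (blk N p) := by
  unfold treeGaugeAt
  have hletter : ∀ a ∈ axial A ((N : ℤ) • blk N p + toSite rr) p, |a| ≤ blockMass N A (blk N p) := by
    intro a ha
    obtain ⟨κ, z', e, hz, -⟩ := mem_axial_hull ha
    have hblk : blk N z' = blk N p := by
      refine blk_eq_of_mem_block hN (fun i => ?_) (fun i => ?_)
      · have hr0 : (0 : ℤ) ≤ (rr i : ℕ) := by positivity
        have a1 := zsmul_blk_le hN p i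
        have eroot : ((N : ℤ) • blk N p + toSite rr) i = ((N : ℤ) • blk N p) i + ((rr i : ℕ) : ℤ) := by
          simp only [Pi.add_apply, toSite]
        have b := (hz i).1
        have : min (((N : ℤ) • blk N p + toSite rr) i) (p i) ≥ ((N : ℤ) • blk N p) i := le_min (by rw [eroot]; omega) a1
        omega
      · have hri : ((rr i : ℕ) : ℤ) < N := by exact_mod_cast Finset.mem_range.1 (Fintype.mem_piFinset.1 hrr i)
        have a2 := lt_zsmul_blk_add hN p i
        have eroot : ((N : ℤ) • blk N p + toSite rr) i = ((N : ℤ) • blk N p) i + ((rr i : ℕ) : ℤ) := by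
          simp only [Pi.add_apply, toSite]
        have b := (hz i).2
        have : max (((N : ℤ) • blk N p + toSite rr) i) (p i) < ((N : ℤ) • blk N p) i + N := max_lt (by rw [eroot]; omega) a2
        omega
    have hb := abs_le_blockMass hN A κ z'
    rw [hblk] at hb
    rcases e with e | e
    · rw [e]; exact hb
    · rw [e, abs_neg]; exact hb
  have hlen : ((axial A ((N : ℤ) • blk N p + toSite rr) p).length : ℝ) ≤ ((d : ℝ) + 1) * N := by
    have h := axial_length_le_of_root hN hrr A p
    exact_mod_cast h
  exact (abs_list_sum_le hletter).trans (mul_le_mul_of_nonneg_right hlen (blockMass_nonneg _ _ _))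

/-- [folklore] A block mean is bounded by any bound on the function over that block. -/
theorem abs_blockMeanAt_le {N : ℕ} (hN : 1 ≤ N) (f : Form0 (d + 1) ℝ) {M : ℝ} {p : Site (d + 1)}
    (h : ∀ b ∈ box (d + 1) N, |f ((N : ℤ) • blk N p + toSite b)| ≤ M) : |blockMeanAt N f p| ≤ M := by
  unfold blockMeanAt AffineAveraging.blockSum
  have hcard : ((box (d + 1) N).card : ℝ) = (N : ℝ) ^ (d + 1) := by
    simp only [AffineAveraging.box, Fintype.card_piFinset, Finset.card_range, Finset.prod_const, Finset.card_univ, Fintype.card_fin]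
    push_cast
    rfl
  have hNpos : (0 : ℝ) < (N : ℝ) ^ (d + 1) := pow_pos (by exact_mod_cast hN) _
  rw [abs_div, abs_of_pos hNpos, div_le_iff₀ hNpos]
  calc |∑ b ∈ box (d + 1) N, f ((N : ℤ) • blk N p + toSite b)| ≤ ∑ b ∈ box (d + 1) N, |f ((N : ℤ) • blk N p + toSite b)| :=
        Finset.abs_sum_le_sum_abs _ _
    _ ≤ ∑ _b ∈ box (d + 1) N, M := Finset.sum_le_sum h
    _ = M * (N : ℝ) ^ (d + 1) := by rw [Finset.sum_const, nsmul_eq_mul, hcard, mul_comm]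

/-- [folklore] **THE BLOCK-MEAN-NORMALISED ROOTED GAUGE IS BOUNDED BY THE BLOCK MASS**: `|bmGaugeAt ρ A N p| ≤ 2·(d+1)·N · blockMass N A (blk N p)`
(the tree integral and its block mean, both read inside the block of `p`). -/
theorem abs_bmGaugeAt_le_blockMass {N : ℕ} (hN : 1 ≤ N) {rr : Fin (d + 1) → ℕ} (hrr : rr ∈ box (d + 1) N) (A : Form1 (d + 1) ℝ)
    (p : Site (d + 1)) : |bmGaugeAt (toSite rr) A N p| ≤ 2 * ((((d : ℝ) + 1) * N) * blockMass N A (blk N p)) := by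
  unfold bmGaugeAt
  rw [Pi.sub_apply]
  have h1 := abs_treeGaugeAt_le_blockMass hN hrr A p
  have h2 : |blockMeanAt N (treeGaugeAt (toSite rr) A N) p| ≤ (((d : ℝ) + 1) * N) * blockMass N A (blk N p) :=
    abs_blockMeanAt_le hN _ fun b hb => by
      have h := abs_treeGaugeAt_le_blockMass hN hrr A ((N : ℤ) • blk N p + toSite b)
      rwa [blk_block (blk N p) hb] at h
  calc |treeGaugeAt (toSite rr) A N p - blockMeanAt N (treeGaugeAt (toSite rr) A N) p|
      ≤ |treeGaugeAt (toSite rr) A N p| + |blockMeanAt N (treeGaugeAt (toSite rr) A N) p| := abs_sub _ _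
    _ ≤ _ := by linarith

/-- [folklore] **`bmGaugeAt ρ A N` OF A COMPONENTWISE SUMMABLE FORM IS SUMMABLE** (in-block root, `N ≥ 1`; majorant `2(d+1)N · blockMass ∘ blk`,
`AxialDressing.summable_blockMass` + `summable_comp_blk`). -/
theorem summable_bmGaugeAt {N : ℕ} (hN : 1 ≤ N) {rr : Fin (d + 1) → ℕ} (hrr : rr ∈ box (d + 1) N) {A : Form1 (d + 1) ℝ}
    (hA : ∀ κ, Summable (A κ)) : Summable (bmGaugeAt (toSite rr) A N) := by
  haveI : NeZero N := ⟨by omega⟩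
  have hmaj : Summable (fun p : Site (d + 1) => 2 * ((((d : ℝ) + 1) * N) * blockMass N A (blk N p))) :=
    ((summable_comp_blk hN (summable_blockMass hA) (blockMass_nonneg N A)).mul_left _).mul_left _
  exact Summable.of_norm_bounded hmaj fun p => by rw [Real.norm_eq_abs]; exact abs_bmGaugeAt_le_blockMass hN hrr A p

/-! ## §3 THE ONE-STEP CLOSED FORM -/

section Literal

variable {Lc : ℕ} [NeZero Lc]

/-- [our object] **THE DRESSED ONE-STEP LEGS OF THE (E) RECURSION IN UNITS, AS A SEQUENCE**: `respStepBmSeq ρ Lc j := respStepBm ρ Lc (Lc^j) (Lc^(j+1))`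
(leaf-01's `respStepBm`; the chains `legChain (respStepBmSeq ρ Lc) m k` are the composite dressed legs `T_{m → m+k+1}`). -/
def respStepBmSeq (ρ : Fin (d + 1) → ℤ) (Lc : ℕ) [NeZero Lc] : ℕ → LegFam d := fun j => respStepBm ρ Lc (Lc ^ j) (Lc ^ (j + 1))

/-- [folklore] `respStepBmSeq`, by `rfl`. -/
theorem respStepBmSeq_apply (ρ : Fin (d + 1) → ℤ) (j : ℕ) : respStepBmSeq (d := d) ρ Lc j = respStepBm ρ Lc (Lc ^ j) (Lc ^ (j + 1)) := rfl

/-- [folklore] **THE ONE-STEP CLOSED FORM** (row V4-c §3; in-block root, every level `m`, summable `ψ`):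
`legAct (respStepBm ρ Lc (Lc^m) (Lc^(m+1))) (dz ψ) = ((Lc^{d+1})⁻¹) • dz (ψ ∘ blk_{Lc})` — gan24-p4's dressed one-step gauge law
`RespStepBmGaugeLaw.dressedStep_exact_eq` (`L = Lc`, `M = Lc^m`, `N′ = Lc^(m+1)`) in the `legAct` currency; no global potential, no Poincaré datum. -/
theorem legAct_respStepBm_dz {rr : Fin (d + 1) → ℕ} (hrr : rr ∈ box (d + 1) Lc) (m : ℕ) {ψ : Form0 (d + 1) ℝ} (hψ : Summable ψ) :
    legAct (respStepBm (toSite rr) Lc (Lc ^ m) (Lc ^ (m + 1))) (dz ψ) = (((Lc : ℝ) ^ (d + 1))⁻¹) • dz (fun x => ψ (blk Lc x)) := by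
  have hLc : 0 < Lc := Nat.pos_of_ne_zero (NeZero.ne Lc)
  have h := dressedStep_exact_eq (d := d) (N' := Lc ^ (m + 1)) hLc hrr (pow_pos hLc m) (pow_succ Lc m) hψ
  funext κ u
  have e : legAct (respStepBm (toSite rr) Lc (Lc ^ m) (Lc ^ (m + 1))) (dz ψ) κ u
      = (fun l'' w' => ∑ μ, ∑' z, dz ψ μ z * coProjBmW (toSite rr) Lc (respStep (d := d) (Lc ^ m) (Lc ^ (m + 1)) μ z) l'' w') κ u := rfl
  rw [e, h]
  simp only [Pi.smul_apply, smul_eq_mul, dz]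
  ring

/-! ## §4 EXACT DATA THROUGH THE CHAIN -/

/-- [folklore] A summable function read through the block label is summable (`AxialDressing.summable_comp_blk` on `|ψ|`). -/
theorem summable_comp_blk' {L : ℕ} (hL : 1 ≤ L) {ψ : Form0 (d + 1) ℝ} (hψ : Summable ψ) : Summable fun x => ψ (blk L x) :=
  Summable.of_norm_bounded (summable_comp_blk hL hψ.abs (fun _ => abs_nonneg _)) fun x => by rw [Real.norm_eq_abs]

/-- [folklore] Iterated block labels: `blk Lc (blk (Lc^k) x) = blk (Lc^(k+1)) x` (floor division by positive integers composes). -/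
theorem blk_blk_pow (Lc k : ℕ) (x : Site (d + 1)) : blk Lc (blk (Lc ^ k) x) = blk (Lc ^ (k + 1)) x := by
  funext i
  simp only [blk]
  push_cast
  rw [Int.ediv_ediv_of_nonneg (by positivity), pow_succ]

/-- [folklore] Every dressed one-step leg of the sequence is in the class `LegL1` (`exists_legL1_respStep` + `legL1_bmW`; constants existential). -/
theorem exists_legL1_respStepBmSeq {rr : Fin (d + 1) → ℕ} (hrr : rr ∈ box (d + 1) Lc) (j : ℕ) :
    ∃ C T : ℝ, LegL1 (respStepBmSeq (d := d) (toSite rr) Lc j) C T := by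
  have hLc : 1 ≤ Lc := Nat.one_le_iff_ne_zero.2 (NeZero.ne Lc)
  obtain ⟨C, T, h⟩ := exists_legL1_respStep (d := d) (M := Lc ^ j) (L := Lc) (N' := Lc ^ (j + 1)) (pow_succ Lc j)
  exact ⟨_, _, legL1_bmW h hLc hrr⟩

/-- [folklore] Every chain of the sequence is BOUNDED (induction on the length with `abs_legComp_le`; constant existential). -/
theorem exists_abs_legChain_le {rr : Fin (d + 1) → ℕ} (hrr : rr ∈ box (d + 1) Lc) (m : ℕ) :
    ∀ k, ∃ C : ℝ, ∀ μ y κ u, |legChain (respStepBmSeq (d := d) (toSite rr) Lc) m k μ y κ u| ≤ C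
  | 0 => by
    obtain ⟨C, T, h⟩ := exists_legL1_respStepBmSeq (d := d) hrr m
    exact ⟨C, fun μ y κ u => by rw [legChain_zero]; exact h.abs_le μ y κ u⟩
  | k + 1 => by
    obtain ⟨C₂, h₂⟩ := exists_abs_legChain_le hrr m k
    obtain ⟨C₁, T₁, h₁⟩ := exists_legL1_respStepBmSeq (d := d) hrr (m + k + 1)
    exact ⟨((d : ℝ) + 1) * T₁ * C₂, fun μ y κ u => by rw [legChain_succ]; exact abs_legComp_le h₁ h₂ μ y κ u⟩

/-- [folklore] **EXACT DATA THROUGH THE CHAIN** (row V4-c §4; in-block root, every `m`, every length `k`, summable `ψ`):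
`legAct (legChain D m k) (dz ψ) = ((Lc^{(d+1)(k+1)})⁻¹) • dz (ψ ∘ blk_{Lc^{k+1}})`, `D = respStepBmSeq ρ Lc` — a coarse pure gauge is transported
down the dressed chain as a BLOCK-CONSTANT pure gauge with the fixed factor `(Lc^{d+1})⁻¹` per level and no other memory (§3 at each level, §1's Fubini,
`blk_{Lc} ∘ blk_{Lc^k} = blk_{Lc^{k+1}}`). -/
theorem legAct_legChain_dz {rr : Fin (d + 1) → ℕ} (hrr : rr ∈ box (d + 1) Lc) (m : ℕ) :
    ∀ (k : ℕ) {ψ : Form0 (d + 1) ℝ}, Summable ψ →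
      legAct (legChain (respStepBmSeq (d := d) (toSite rr) Lc) m k) (dz ψ)
        = (((Lc : ℝ) ^ ((d + 1) * (k + 1)))⁻¹) • dz (fun x => ψ (blk (Lc ^ (k + 1)) x))
  | 0, ψ, hψ => by
    rw [legChain_zero, respStepBmSeq_apply, legAct_respStepBm_dz hrr m hψ]
    simp only [Nat.zero_add, Nat.mul_one, pow_one]
  | k + 1, ψ, hψ => by
    have hLc : 1 ≤ Lc := Nat.one_le_iff_ne_zero.2 (NeZero.ne Lc)
    have hLc0 : (Lc : ℝ) ≠ 0 := by exact_mod_cast (NeZero.ne Lc)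
    obtain ⟨C₁, T₁, h₁⟩ := exists_legL1_respStepBmSeq (d := d) hrr (m + k + 1)
    obtain ⟨C₂, h₂⟩ := exists_abs_legChain_le (d := d) hrr m k
    rw [legChain_succ, legAct_legComp (fun μ => summable_dz hψ μ) h₁ h₂, respStepBmSeq_apply,
      legAct_respStepBm_dz hrr (m + k + 1) hψ, legAct_smul, legAct_legChain_dz hrr m k (summable_comp_blk' hLc hψ), smul_smul]
    congr 1
    · rw [← mul_inv, ← pow_add]
      congr 2
      ring
    · congr 1
      funext x
      rw [blk_blk_pow]

end Literal

end Summit.QuantumFields.BalabanUV.Beta.GAN24.RespStepBmDecompExact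

end
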